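import Literature.Topology.FourManifolds.SurfaceGroupNielsenDegreeForm
import HarnessLib

/-!
# Nielsen's lifting theorem after Zieschang: the assembly (ZVC Thm. 5.6.1 from its pillars)

Topic `Literature/Topology/FourManifolds`.  The deduction of Nielsen's theorem
(`nielsen_surfaceGroup_mulEquiv_lift`: every automorphism of `S_g` is induced by an automorphism
of the free group sending `r_g` to a conjugate of `r_g^{±1}`) from the five pillars of
`SurfaceGroupNielsenSetup.lean`, exactly as in the proof of Zieschang–Vogt–Coldewey Thm. 5.6.1:
lift `α` to an endomorphism; by the block lemma (A3) the lifted binary product is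
indecomposable (ZVC Thm. 5.3.6), so (CORE) it is homotopic to one whose boundary path is a
simple circuit (ZVC Cor. 5.3.5); by (C1) its degree is `±1` (ZVC 5.5), so by the planar
counting (B) the boundary path is the relator up to rotation and inversion (ZVC Cor. 5.4.3), i.e.
the new endomorphism sends `r_g` to a conjugate of `r_g^{±1}`; by (C2) it is an automorphism
(ZVC Cor. 5.2.13).  Genus `≤ 1` is unconditional (`SurfaceGroupNielsenGenusOne.lean`).

Also here: the degree of a signed product of conjugates (`relatorDegree_conjProd`), conjugation
invariance of the degree on the relation subgroup, indecomposability and marked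
non-triviality of automorphic assignments (from the block lemma, resp. by abelianisation).

## References

* H. Zieschang, E. Vogt, H.-D. Coldewey, *Surfaces and Planar Discontinuous Groups*, LNM 835
  (1980), proof of Thm. 5.6.1. [ZieschangVogtColdewey1980]
* J. Nielsen, *Untersuchungen zur Topologie der geschlossenen zweiseitigen Flächen*, Acta Math.
  50 (1927) 189–358. [Nielsen1927]
-/

noncomputable section

namespace Literature.Topology.FourManifolds

open Literature.GroupTheory.CombinatorialGroupTheory List

namespace SurfaceGroup

variable {g : ℕ}

/-! ## Indecomposability and marked non-triviality of automorphic assignments -/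

/-- The lift of an automorphic assignment is `α ∘ proj`. [folklore] -/
theorem lift_aut_assignment (α : SurfaceGroup g ≃* SurfaceGroup g) :
    FreeGroup.lift (fun i : surfaceGen g => α (PresentedGroup.of i)) = α.toMonoidHom.comp (proj g) := by
  refine FreeGroup.ext_hom _ _ fun i => ?_
  simp [PresentedGroup.of]

/-- **(A3) ⇒ indecomposability of every automorphic assignment** (ZVC Thm. 5.3.6).
[cite: ZieschangVogtColdewey1980, Thm. 5.3.6] -/
theorem indecomposable_of_blockLemma (hA : BlockLemma g) (α : SurfaceGroup g ≃* SurfaceGroup g) :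
    Indecomposable (fun i : surfaceGen g => α (PresentedGroup.of i)) := by
  intro ψ A P B hψ hq hdisj hP hAB
  rw [lift_aut_assignment]
  simp only [MonoidHom.coe_comp, MulEquiv.coe_toMonoidHom, Function.comp_apply, ne_eq,
    EmbeddingLike.map_eq_one_iff]
  exact hA ψ A P B hψ hq hdisj hP hAB

/-- The abelianisation values on generators: `x ↦ e_x`. [folklore] -/
def abelOnGens (g : ℕ) : surfaceGen g → Multiplicative (surfaceGen g → ℤ) :=
  fun x => Multiplicative.ofAdd (Pi.single x 1)

/-- The abelianisation `F⟨a, b⟩ →* ℤ^{a, b}` on generators. [folklore] -/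
def freeAbel (g : ℕ) : FreeGroup (surfaceGen g) →* Multiplicative (surfaceGen g → ℤ) :=
  FreeGroup.lift (abelOnGens g)

/-- The abelianisation factors through `S_g`. [folklore] -/
theorem freeAbel_eq_comp : freeAbel g = (SurfaceGroup.toCommGroup (abelOnGens g)).comp (proj g) := by
  refine FreeGroup.ext_hom _ _ fun i => ?_
  simp only [freeAbel, FreeGroup.lift_apply_of, MonoidHom.coe_comp, Function.comp_apply]
  exact (SurfaceGroup.toCommGroup_of _ i).symm

/-- The linear endomorphism of `ℤ^{a,b}` with prescribed values on the standard basis. [folklore] -/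
def linOfValues (v : surfaceGen g → (surfaceGen g → ℤ)) : (surfaceGen g → ℤ) →ₗ[ℤ] (surfaceGen g → ℤ) :=
  (Pi.basisFun ℤ (surfaceGen g)).constr ℤ v

/-- `linOfValues v` on a basis vector. [folklore] -/
theorem linOfValues_single (v : surfaceGen g → (surfaceGen g → ℤ)) (x : surfaceGen g) :
    linOfValues v (Pi.single x 1) = v x := by
  rw [linOfValues, ← Pi.basisFun_apply, Module.Basis.constr_basis]

/-- A `ℤ^{a,b}`-valued character of the free group factors through the abelianisation by the
linear map with the same values on generators. [folklore] -/
theorem toAdd_char_eq (χ : FreeGroup (surfaceGen g) →* Multiplicative (surfaceGen g → ℤ))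
    (y : FreeGroup (surfaceGen g)) :
    Multiplicative.toAdd (χ y) =
      linOfValues (fun x => Multiplicative.toAdd (χ (FreeGroup.of x))) (Multiplicative.toAdd (freeAbel g y)) := by
  set M := linOfValues (fun x => Multiplicative.toAdd (χ (FreeGroup.of x))) with hM
  have key : χ = (AddMonoidHom.toMultiplicative M.toAddMonoidHom).comp (freeAbel g) := by
    refine FreeGroup.ext_hom _ _ fun x => ?_
    simp only [MonoidHom.coe_comp, Function.comp_apply, freeAbel, abelOnGens, FreeGroup.lift_apply_of]
    change χ (FreeGroup.of x) = Multiplicative.ofAdd (M (Multiplicative.toAdd (Multiplicative.ofAdd (Pi.single x (1 : ℤ)))))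
    rw [toAdd_ofAdd, hM, linOfValues_single, ofAdd_toAdd]
  conv_lhs => rw [key]
  rfl

/-- **Automorphisms of the free group never carry a generator into the relation subgroup**
(a primitive element is not a product of conjugates of commutators: abelianise).  Hence every
automorphic assignment is marked non-trivial. [folklore] -/
theorem proj_mulEquiv_of_ne_one (ψ : FreeGroup (surfaceGen g) ≃* FreeGroup (surfaceGen g)) (i : surfaceGen g) :
    proj g (ψ (FreeGroup.of i)) ≠ 1 := by
  intro h
  -- the abelianisation of `ψ (of i)` vanishes
  have h0 : Multiplicative.toAdd (freeAbel g (ψ (FreeGroup.of i))) = 0 := by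
    rw [freeAbel_eq_comp, MonoidHom.comp_apply, h, map_one]; rfl
  -- the matrices of `ψ` and `ψ⁻¹`
  set χ : FreeGroup (surfaceGen g) →* Multiplicative (surfaceGen g → ℤ) := (freeAbel g).comp ψ.toMonoidHom
  set χ' : FreeGroup (surfaceGen g) →* Multiplicative (surfaceGen g → ℤ) := (freeAbel g).comp ψ.symm.toMonoidHom
  set M := linOfValues (fun x => Multiplicative.toAdd (χ (FreeGroup.of x)))
  set M' := linOfValues (fun x => Multiplicative.toAdd (χ' (FreeGroup.of x)))
  have hMM' : M' (M (Pi.single i 1)) = Pi.single i 1 := by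
    have e1 : M (Pi.single i 1) = Multiplicative.toAdd (freeAbel g (ψ (FreeGroup.of i))) := by
      have := toAdd_char_eq χ (FreeGroup.of i)
      simp only [χ, MonoidHom.coe_comp, MulEquiv.coe_toMonoidHom, Function.comp_apply, freeAbel,
        abelOnGens, FreeGroup.lift_apply_of, toAdd_ofAdd] at this
      simpa [M, χ, freeAbel, abelOnGens] using this.symm
    have e2 : M' (Multiplicative.toAdd (freeAbel g (ψ (FreeGroup.of i)))) =
        Multiplicative.toAdd (χ' (ψ (FreeGroup.of i))) := (toAdd_char_eq χ' (ψ (FreeGroup.of i))).symm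
    rw [e1, e2]
    simp [χ', freeAbel, abelOnGens]
  have hMe : M (Pi.single i 1) = 0 := by
    have := toAdd_char_eq χ (FreeGroup.of i)
    simp only [χ, MonoidHom.coe_comp, MulEquiv.coe_toMonoidHom, Function.comp_apply] at this
    rw [h0] at this
    simpa [freeAbel, abelOnGens, M, χ] using this.symm
  have hzero : (Pi.single i (1 : ℤ) : surfaceGen g → ℤ) = 0 := by
    rw [← hMM', hMe, map_zero]
  have := congrFun hzero i
  simp at this

/-- **Every automorphic assignment is marked non-trivial.** [folklore] -/
theorem markedNontrivial_aut (α : SurfaceGroup g ≃* SurfaceGroup g) :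
    MarkedNontrivial (fun i : surfaceGen g => α (PresentedGroup.of i)) := by
  intro ψ i
  rw [lift_aut_assignment]
  simp only [MonoidHom.coe_comp, MulEquiv.coe_toMonoidHom, Function.comp_apply, ne_eq,
    EmbeddingLike.map_eq_one_iff]
  exact proj_mulEquiv_of_ne_one ψ i

/-! ## Rotations of the relator word and cyclic reduction -/

/-- A rotation of a word is a conjugate in the free group. [folklore] -/
theorem exists_mk_rotate_eq_conj {ι : Type*} (w : List (ι × Bool)) (k : ℕ) :
    ∃ d : FreeGroup ι, FreeGroup.mk (w.rotate k) = d * FreeGroup.mk w * d⁻¹ := by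
  rw [List.rotate_eq_drop_append_take_mod]
  refine ⟨(FreeGroup.mk (w.take (k % w.length)))⁻¹, ?_⟩
  have hw : FreeGroup.mk w = FreeGroup.mk (w.take (k % w.length)) * FreeGroup.mk (w.drop (k % w.length)) := by
    rw [← mk_append, List.take_append_drop]
  rw [hw, mk_append]
  group

/-- A rotation of the relator word, or of its formal inverse, is a conjugate of `r^{±1}`. [folklore] -/
theorem exists_conj_of_rotate {w : List (surfaceGen g × Bool)} {k : ℕ}
    (h : w = (surfaceWordStd g).rotate k ∨ w = (FreeGroup.invRev (surfaceWordStd g)).rotate k) :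
    ∃ (e : FreeGroup (surfaceGen g)) (ε : ℤ), (ε = 1 ∨ ε = -1) ∧
      FreeGroup.mk w = e * surfaceRelator g ^ ε * e⁻¹ := by
  rcases h with rfl | rfl
  · obtain ⟨d, hd⟩ := exists_mk_rotate_eq_conj (surfaceWordStd g) k
    exact ⟨d, 1, Or.inl rfl, by rw [hd, mk_surfaceWordStd, zpow_one]⟩
  · obtain ⟨d, hd⟩ := exists_mk_rotate_eq_conj (FreeGroup.invRev (surfaceWordStd g)) k
    refine ⟨d, -1, Or.inr rfl, ?_⟩
    rw [hd, ← FreeGroup.inv_mk, mk_surfaceWordStd, zpow_neg, zpow_one]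

/-- Every element is conjugate to its cyclic reduction. [folklore] -/
theorem exists_eq_conj_mk_reduceCyclically {ι : Type*} [DecidableEq ι] (x : FreeGroup ι) :
    ∃ d : FreeGroup ι, x = d * FreeGroup.mk (FreeGroup.reduceCyclically x.toWord) * d⁻¹ := by
  refine ⟨FreeGroup.mk (FreeGroup.reduceCyclically.conjugator x.toWord), ?_⟩
  conv_lhs => rw [← FreeGroup.mk_toWord (x := x),
    ← FreeGroup.reduceCyclically.conj_conjugator_reduceCyclically x.toWord]
  rw [mk_append, mk_append, FreeGroup.inv_mk]

/-! ## Nielsen's theorem from the pillars (ZVC Thm. 5.6.1) -/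

/-- **Nielsen's theorem for `S_g` from the five pillars** (the proof of ZVC Thm. 5.6.1): lift `α`
to an endomorphism, shorten homotopically to a simple circuit (CORE, using the block lemma for
indecomposability), read off degree `±1` (C1), conclude by planar counting (B) that the new
endomorphism sends `r_g` to a conjugate of `r_g^{±1}`, hence is an automorphism (C2).
[cite: ZieschangVogtColdewey1980, Thm. 5.6.1] -/
theorem liftable_of_pillars (hg : 1 ≤ g) (hA : BlockLemma g) (hC : HomotopicSimple g)
    (hB : SimpleCircuitRotation g) (hD : DegreeOfAut g) (hE : RelatorEndIsAut g)
    (α : SurfaceGroup g ≃* SurfaceGroup g) : Liftable α := by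
  -- the automorphic assignment and a lift of it
  set φ : surfaceGen g → SurfaceGroup g := fun i => α (PresentedGroup.of i) with hφ
  obtain ⟨X, hX⟩ : ∃ X : surfaceGen g → FreeGroup (surfaceGen g), ∀ i, proj g (X i) = φ i :=
    ⟨fun i => (PresentedGroup.mk_surjective _ (φ i)).choose,
      fun i => (PresentedGroup.mk_surjective _ (φ i)).choose_spec⟩
  -- CORE: a homotopic lift with a simple boundary circuit
  obtain ⟨X', hX', hsimple⟩ :=
    hC φ (indecomposable_of_blockLemma hA α) (markedNontrivial_aut α) X hX
  set Φ : FreeGroup (surfaceGen g) →* FreeGroup (surfaceGen g) := FreeGroup.lift X' with hΦdef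
  have hΦ : ∀ x, proj g (Φ x) = α (proj g x) := by
    intro x
    have e : (proj g).comp Φ = α.toMonoidHom.comp (proj g) := by
      refine FreeGroup.ext_hom _ _ fun i => ?_
      simp only [MonoidHom.coe_comp, Function.comp_apply, hΦdef, FreeGroup.lift_apply_of, hX' i, hφ,
        MulEquiv.coe_toMonoidHom]
      rfl
    exact DFunLike.congr_fun e x
  set V := Φ (surfaceRelator g) with hVdef
  have hVker : V ∈ (proj g).ker := by
    rw [MonoidHom.mem_ker, hVdef, hΦ, mk_surfaceRelator, map_one]
  -- the cyclically reduced boundary word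
  set w := FreeGroup.reduceCyclically (FreeGroup.toWord V) with hwdef
  obtain ⟨d, hd⟩ := exists_eq_conj_mk_reduceCyclically V
  rw [← hwdef] at hd
  have hwker : FreeGroup.mk w ∈ (proj g).ker := by
    have : FreeGroup.mk w = d⁻¹ * V * d⁻¹⁻¹ := by rw [hd]; group
    rw [this]
    exact (MonoidHom.normal_ker (proj g)).conj_mem _ hVker _
  obtain ⟨L, hL⟩ := exists_conjProd_of_mem_ker hwker
  -- degree ±1
  have hdegw : relatorDegree g (FreeGroup.mk w) = g * signSum L := by rw [hL, relatorDegree_conjProd]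
  have hdegV : relatorDegree g V = relatorDegree g (FreeGroup.mk w) := by
    rw [hd, relatorDegree_conj_of_mem_ker _ hwker]
  have hsign : signSum L = 1 ∨ signSum L = -1 := by
    have hg0 : (g : ℤ) ≠ 0 := by exact_mod_cast (Nat.one_le_iff_ne_zero.1 hg)
    rcases hD α Φ hΦ with h | h
    · left
      rw [← hVdef, hdegV, hdegw] at h
      have : (g : ℤ) * signSum L = g * 1 := by rw [h, mul_one]
      exact mul_left_cancel₀ hg0 this
    · right
      rw [← hVdef, hdegV, hdegw] at h
      have : (g : ℤ) * signSum L = g * (-1) := by rw [h, mul_neg_one]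
      exact mul_left_cancel₀ hg0 this
  -- planar counting: the boundary word is the relator up to rotation and inversion
  obtain ⟨k, hk⟩ := hB w L hsimple hL hsign
  obtain ⟨e, ε, hε, he⟩ := exists_conj_of_rotate hk
  have hV : Φ (surfaceRelator g) = (d * e) * surfaceRelator g ^ ε * (d * e)⁻¹ := by
    rw [← hVdef, hd, he]; group
  -- Zieschang–Nielsen: the endomorphism is an automorphism
  have hbij := hE Φ (d * e) ε hε hV
  refine ⟨MulEquiv.ofBijective Φ hbij, d * e, ε, hε, ?_, fun x => ?_⟩
  · simpa using hV
  · exact hΦ x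

/-- **Nielsen's lifting theorem from the pillars in every genus `≥ 2`** (genus `≤ 1` is
unconditional). [cite: ZieschangVogtColdewey1980, Thm. 5.6.1] [cite: Nielsen1927] -/
theorem nielsen_of_pillars
    (H : ∀ g : ℕ, 2 ≤ g → BlockLemma g ∧ HomotopicSimple g ∧ SimpleCircuitRotation g ∧
      DegreeOfAut g ∧ RelatorEndIsAut g) :
    nielsen_surfaceGroup_mulEquiv_lift := by
  intro g α
  by_cases hg : g ≤ 1
  · exact nielsen_surfaceGroup_mulEquiv_lift_of_le_one g hg α
  · obtain ⟨hA, hC, hB, hD, hE⟩ := H g (by omega)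
    exact liftable_of_pillars (by omega) hA hC hB hD hE α

end SurfaceGroup

end Literature.Topology.FourManifolds

end
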